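import Literature.NumberTheory.Rogawski1990.SingularSemisimpleFrame        -- ★ `exists_singular_frame` (the adapted frame `γP = P(a·1₂ ⊕ b·1₁)`, `c(a)a = c(b)b = 1`; Prop. 3.8.1 (a))
import Literature.NumberTheory.Rogawski1990.GlobalTransferFactor           -- ★ `cmRationalToArch` (`γ ↦ γ ⊗ 1`), `coe_cmRationalToArch`
import Literature.NumberTheory.Automorphic.ArchStableConjugacyLocalGlobal   -- ★ `IsStablyConj` on `arch` (= `IsConj` of the `GL₃(L ⊗ ℝ)` values), `isStablyConj_arch_iff_forall_place`
import Literature.NumberTheory.Automorphic.ArchDiagonalTorus               -- ★ `archDiagTorus`, `coe_archDiagTorus_eq_diagonal`, `norm_embedding_eq_one_of_complexConj_mul_self`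
import Literature.NumberTheory.Automorphic.GodementHeightFloor             -- ★ `Godement.det_ne_zero_of_anisotropic`
import HarnessLib

/-!
# The wall torus point of a split-semisimple rational element: `γ₀ ⊗ 1` with `(γ₀ − e₁)(γ₀ − e₂) = 0`, `e₁ ≠ e₂`, non-central, is `GL₃(L ⊗ ℝ)`-conjugate to the torus point
# `t(z⁰)`, `z⁰_w = (σ_w e₁, σ_w e₂, σ_w e₁)` — a WALL point `z⁰_w 0 = z⁰_w 2 ≠ z⁰_w 1` at every complex place (Rogawski 1990 §3.8 Prop. 3.8.1 (a), §14.2 p. 232, §8.2 p. 117)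

Topic `NumberTheory/Rogawski1990`; namespace `Literature.NumberTheory.Rogawski1990`.  THEOREMS ONLY (no `def`, no instance, no notation, no axiom, no named fact, no `sorry`).
Cell `pub/hodgecm-mathlib`, ENGINE T1 (crux H413 = `stmt-HodgeConjecture-24833`); floor-1½ preparation, count-neutral, under books row #88 (ST-∞) ∕ `stub_LuseAllPlaces`: brick
**(m2) «WALL TORUS POINT OF A SPLIT RATIONAL ELEMENT»** of F0P3a-p07 (g7)'s (R1-e) census 31a194b6 §2 (ii) (LEAD F0P3a-plan (g9) WORD T8-99 (A); shed to this seat 06:34Z; author F0P3a-p05 (g12)).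

THE MATHEMATICS.  `L` CM with conjugation `c`, `H′ ∈ M₃(L)` `c`-hermitian and anisotropic (so `det H′ ≠ 0`), `γ₀ ∈ U(H′)(L⁺)` rational with `(γ₀ − e₁)(γ₀ − e₂) = 0`, `e₁ ≠ e₂`, and
`γ₀ ∉ {e₁·1, e₂·1}` (non-central).  ★ `exists_singular_frame` [Prop. 3.8.1 (a)] gives `P ∈ GL₃(L)` and the ordering `{a, b} = {e₁, e₂}` (the `a`-eigenspace is the PLANE) with
`γ₀ P = P (a·1₂ ⊕ b·1₁)` and `c(a)a = c(b)b = 1` (unitarity + anisotropy); so `γ₀ = Q · diag(a, b, a) · Q⁻¹` with `Q = P·W`, `W` the transposition matrix of the slots `1, 2` (§1–§2), the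
characteristic polynomial is `(X − a)²(X − b)` (so the (κ-MASS) clause's `charpoly γ₀ = (X − e₁)²(X − e₂)` pins `a = e₁`), and `|σ_w a| = |σ_w b| = 1` at every complex place
(★ `norm_embedding_eq_one_of_complexConj_mul_self`).  Pushing along `γ ↦ γ ⊗ 1` (★ `cmRationalToArch`, entrywise `mixedEmbedding`) and reading `diag(d) ⊗ 1 = t(z_d)`,
`(z_d)_{w,i} = σ_w(d_i) ∈ S¹` (★ `coe_archDiagTorus_eq_diagonal`; a CM field has no real places, ★ `mixedSpace_ext`), `γ₀ ⊗ 1` is conjugate IN `GL₃(L ⊗ ℝ)` — i.e. STABLY conjugate in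
`G′_∞` after any congruence `Ψ : U(H′)(L ⊗ ℝ) ≃ U(diag α′)(L ⊗ ℝ)`, `g ↦ S g S⁻¹` (★ (T-d)) — to the torus point `t(z⁰)`, `z⁰_w = (σ_w e₁, σ_w e₂, σ_w e₁)`: a WALL point of the diagonal torus
of `U(diag α′)`, `z⁰_w 0 = z⁰_w 2 ≠ z⁰_w 1` at EVERY `w` — the `hwall` of ★ p841776 `exists_wallCoef_sum_prod_mul_eq_of_regular_eq`, where (R1-e) reads the (ST-∞) members by ★
`stableOrbitalIntegralRel_congr_of_rel`.
* §1 private matrix bookkeeping over a field: `a·1₂ ⊕ b·1₁ = diag(a,a,b)`, `diag(a,a,b) = W·diag(a,b,a)·W` (`W² = 1`), `charpoly diag(a,b,a)`, `(X−b)²(X−a) ≠ (X−a)²(X−b)`.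
* §2 **`exists_eq_conj_diagonal_of_split`** (`∃ a b Q, {a,b} = {e₁,e₂} ∧ c(a)a = 1 ∧ c(b)b = 1 ∧ γ₀ = Q·diag(a,b,a)·Q⁻¹ ∧ charpoly γ₀ = (X−a)²(X−b)`); `…_of_charpoly` (the (κ-MASS) pin `a = e₁`).
* §3 the archimedean reading: `map_mixedEmbedding_diagonal_eq_coe_archDiagTorus` (`diag(d) ⊗ 1 = t(z)` for ANY `z` with `z_{w,i} = σ_w d_i`, ANY carrier weights `α′`), **`isConj_coe_cmRationalToArch_coe_archDiagTorus`** (`GL₃(L ⊗ ℝ)`-conjugacy).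
* §4 HEADS: **`exists_isStablyConj_cmRationalToArch_archDiagTorus_wall`** ((κ-MASS) binders in; `∃ (h₁ : c(e₁)e₁ = 1) (h₂ : c(e₂)e₂ = 1), IsStablyConj … (Ψ (γ₀ ⊗ 1)) (t(z⁰))` out) and the
  swap-free `…_of_ne_smul_one` ((ST-∞) binders + non-centrality, `{a,b} = {e₁,e₂}`); `ne_of_embedding` bookkeeping for the wall shape (`z⁰_w 0 = z⁰_w 2`, `z⁰_w 0 ≠ z⁰_w 1`).
HONEST LABEL: HC_CM is proved only modulo the printed citations until rung 0 closes; this file is linear algebra over ★ cell files and pays nothing by itself.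

## References
* [Rogawski1990] J. D. Rogawski, *Automorphic Representations of Unitary Groups in Three Variables*, Ann. of Math. Stud. 123 (1990), §3.8 Prop. 3.8.1 (a) p. 27 (singular semisimple
  elements: eigenvalues `{a, a, b}`, `G_γ = U(2) × U(1)`-type), §14.2 p. 232, §8.2 p. 117 (the split-singular `γ₀` and the wall of the compact Cartan), §3.1 p. 19 (stable conjugacy).
* [BorelJacquet1979] A. Borel, H. Jacquet, *Automorphic forms and automorphic representations*, PSPM 33.1 (1979), §4.1 (`γ ↦ γ ⊗ 1`, `G_∞ = Π_v G(F_v)`).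
-/

set_option autoImplicit false

noncomputable section

open NumberField NumberField.InfinitePlace NumberField.mixedEmbedding Matrix Polynomial
open scoped MatrixGroups

namespace Literature.NumberTheory.Rogawski1990

open Literature.NumberTheory.Automorphic
open Literature.NumberTheory.Automorphic.UnitaryGroup hiding hermForm
open Literature.AlgebraicGeometry.ShimuraVarieties (unitaryGroup mem_unitaryGroup_iff hermForm)

/-! ## §1 Matrix bookkeeping over a field -/

section Algebra

variable {K : Type*} [Field K]

/-- `a·1₂ ⊕ b·1₁ = diag(a, a, b)` (★ `finSum`). [folklore] -/
private theorem finSum_smul_one_smul_one_eq_diagonal (a b : K) :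
    finSum 2 1 (a • (1 : Matrix (Fin 2) (Fin 2) K)) (b • (1 : Matrix (Fin 1) (Fin 1) K)) = Matrix.diagonal ![a, a, b] := by
  rw [finSum, Matrix.smul_one_eq_diagonal, Matrix.smul_one_eq_diagonal, Matrix.fromBlocks_diagonal, Matrix.reindex_apply,
    Matrix.submatrix_diagonal_equiv]
  congr 1
  funext i
  fin_cases i <;> rfl

/-- The transposition matrix of the slots `1, 2` squares to `1`. [folklore] -/
private theorem swapMatrix_mul_swapMatrix : (!![(1 : K), 0, 0; 0, 0, 1; 0, 1, 0] : Matrix (Fin 3) (Fin 3) K) * !![(1 : K), 0, 0; 0, 0, 1; 0, 1, 0] = 1 := by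
  ext i j
  fin_cases i <;> fin_cases j <;> simp [Matrix.mul_apply, Fin.sum_univ_three]

/-- `W · diag(a, b, a) · W = diag(a, a, b)` for the transposition matrix `W` of the slots `1, 2`. [folklore] -/
private theorem swapMatrix_mul_diagonal_mul_swapMatrix (a b : K) :
    (!![(1 : K), 0, 0; 0, 0, 1; 0, 1, 0] : Matrix (Fin 3) (Fin 3) K) * Matrix.diagonal ![a, b, a] * !![(1 : K), 0, 0; 0, 0, 1; 0, 1, 0] = Matrix.diagonal ![a, a, b] := by
  have hd : (Matrix.diagonal ![a, b, a] : Matrix (Fin 3) (Fin 3) K) = !![a, 0, 0; 0, b, 0; 0, 0, a] := by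
    ext i j
    fin_cases i <;> fin_cases j <;> simp [Matrix.diagonal]
  have hd' : (Matrix.diagonal ![a, a, b] : Matrix (Fin 3) (Fin 3) K) = !![a, 0, 0; 0, a, 0; 0, 0, b] := by
    ext i j
    fin_cases i <;> fin_cases j <;> simp [Matrix.diagonal]
  rw [hd, hd']
  ext i j
  fin_cases i <;> fin_cases j <;> simp [Matrix.mul_apply, Fin.sum_univ_three]

/-- `charpoly diag(a, b, a) = (X − a)² (X − b)`. [folklore] -/
private theorem charpoly_diagonal_aba (a b : K) : (Matrix.diagonal ![a, b, a]).charpoly = (X - C a) ^ 2 * (X - C b) := by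
  rw [Matrix.charpoly_diagonal, Fin.prod_univ_three]
  simp only [Matrix.cons_val_zero, Matrix.cons_val_one, Matrix.cons_val_two, Matrix.head_cons, Matrix.tail_cons]
  ring

/-- `(X − b)²(X − a) ≠ (X − a)²(X − b)` for `a ≠ b` (count the root `a`). [folklore] -/
private theorem sq_mul_ne_sq_mul_of_ne {a b : K} (hab : a ≠ b) : (X - C b) ^ 2 * (X - C a) ≠ (X - C a) ^ 2 * (X - C b) := by
  classical
  intro h
  have hne : ∀ x y : K, (X - C x) ^ 2 * (X - C y) ≠ 0 := fun x y =>
    mul_ne_zero (pow_ne_zero _ (X_sub_C_ne_zero x)) (X_sub_C_ne_zero y)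
  have h1 : (((X - C b) ^ 2 * (X - C a)).roots).count a = (((X - C a) ^ 2 * (X - C b)).roots).count a := by rw [h]
  rw [Polynomial.roots_mul (hne b a), Polynomial.roots_mul (hne a b), Polynomial.roots_pow, Polynomial.roots_pow] at h1
  simp only [Polynomial.roots_X_sub_C, Multiset.count_add, Multiset.count_nsmul, Multiset.count_singleton, hab, if_false, if_true,
    mul_zero, zero_add, mul_one, add_zero] at h1
  exact absurd h1 (by norm_num)

end Algebra

/-! ## §2 The rational frame: `γ₀ = Q · diag(a, b, a) · Q⁻¹` over `L` -/

section Frame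

variable (L : Type) [Field L] [NumberField L] [IsCMField L] (H' : Matrix (Fin 3) (Fin 3) L)

/-- **A SPLIT-SEMISIMPLE NON-CENTRAL RATIONAL ELEMENT IS `GL₃(L)`-CONJUGATE TO `diag(a, b, a)` WITH CM-UNIMODULAR `a ≠ b`**: for `H′` hermitian anisotropic, `γ₀ ∈ U(H′)(L⁺)` with
`(γ₀ − e₁)(γ₀ − e₂) = 0`, `e₁ ≠ e₂`, `γ₀ ≠ e₁·1, e₂·1` there are `{a, b} = {e₁, e₂}` (the `a`-eigenspace being the plane) and `Q ∈ GL₃(L)` with `c(a)a = c(b)b = 1`,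
`γ₀ = Q · diag(a, b, a) · Q⁻¹` and `charpoly γ₀ = (X − a)²(X − b)` (★ `exists_singular_frame` [Prop. 3.8.1 (a)], then `Q = P · W₁₂`). [cite: Rogawski1990, §3.8 Prop. 3.8.1 p. 27] -/
theorem exists_eq_conj_diagonal_of_split (hherm : (H'.map (cmConjRingHom L))ᵀ = H') (hanis : ∀ x : Fin 3 → L, hermForm (cmConjRingHom L) H' x x = 0 → x = 0)
    (γ₀ : unitaryGroup (cmConjRingHom L) H') {e₁ e₂ : L} (he : e₁ ≠ e₂)
    (hsplit : (((γ₀ : GL (Fin 3) L) : Matrix (Fin 3) (Fin 3) L) - e₁ • (1 : Matrix (Fin 3) (Fin 3) L)) * (((γ₀ : GL (Fin 3) L) : Matrix (Fin 3) (Fin 3) L) - e₂ • (1 : Matrix (Fin 3) (Fin 3) L)) = 0)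
    (hne₁ : ((γ₀ : GL (Fin 3) L) : Matrix (Fin 3) (Fin 3) L) ≠ e₁ • (1 : Matrix (Fin 3) (Fin 3) L)) (hne₂ : ((γ₀ : GL (Fin 3) L) : Matrix (Fin 3) (Fin 3) L) ≠ e₂ • (1 : Matrix (Fin 3) (Fin 3) L)) :
    ∃ (a b : L) (Q : GL (Fin 3) L), ((a = e₁ ∧ b = e₂) ∨ (a = e₂ ∧ b = e₁)) ∧ cmConjRingHom L a * a = 1 ∧ cmConjRingHom L b * b = 1 ∧
      ((γ₀ : GL (Fin 3) L) : Matrix (Fin 3) (Fin 3) L) = (Q : Matrix (Fin 3) (Fin 3) L) * Matrix.diagonal ![a, b, a] * ((Q⁻¹ : GL (Fin 3) L) : Matrix (Fin 3) (Fin 3) L) ∧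
      ((γ₀ : GL (Fin 3) L) : Matrix (Fin 3) (Fin 3) L).charpoly = (X - C a) ^ 2 * (X - C b) := by
  have hσ : ∀ x : L, cmConjRingHom L (cmConjRingHom L x) = x := fun x => by
    rw [cmConjRingHom_apply, cmConjRingHom_apply, IsCMField.complexConj_apply_apply]
  have hdet : H'.det ≠ 0 := Godement.det_ne_zero_of_anisotropic L H' hanis
  obtain ⟨a, b, P, Ha, Hb, hab, ha, hb, -, hγP, -, -, -, -⟩ := exists_singular_frame (cmConjRingHom L) hσ H' hherm hdet γ₀ he hsplit hne₁ hne₂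
  -- the conjugator `Q = P · W`
  set W : Matrix (Fin 3) (Fin 3) L := !![(1 : L), 0, 0; 0, 0, 1; 0, 1, 0] with hW
  have hWW : W * W = 1 := swapMatrix_mul_swapMatrix
  set Wu : GL (Fin 3) L := ⟨W, W, hWW, hWW⟩ with hWu
  have hPinv : ((P : Matrix (Fin 3) (Fin 3) L)) * ((P⁻¹ : GL (Fin 3) L) : Matrix (Fin 3) (Fin 3) L) = 1 := Units.mul_inv P
  have hγ : ((γ₀ : GL (Fin 3) L) : Matrix (Fin 3) (Fin 3) L) = (P : Matrix (Fin 3) (Fin 3) L) * Matrix.diagonal ![a, a, b] * ((P⁻¹ : GL (Fin 3) L) : Matrix (Fin 3) (Fin 3) L) := by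
    rw [← finSum_smul_one_smul_one_eq_diagonal, ← hγP, Matrix.mul_assoc, hPinv, Matrix.mul_one]
  refine ⟨a, b, P * Wu, hab, ha, hb, ?_, ?_⟩
  · rw [hγ, ← swapMatrix_mul_diagonal_mul_swapMatrix, _root_.mul_inv_rev, Units.val_mul, Units.val_mul]
    change (P : Matrix (Fin 3) (Fin 3) L) * (W * Matrix.diagonal ![a, b, a] * W) * ((P⁻¹ : GL (Fin 3) L) : Matrix (Fin 3) (Fin 3) L) =
      (P : Matrix (Fin 3) (Fin 3) L) * W * Matrix.diagonal ![a, b, a] * (W * ((P⁻¹ : GL (Fin 3) L) : Matrix (Fin 3) (Fin 3) L))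
    simp only [Matrix.mul_assoc]
  · rw [hγ, ← swapMatrix_mul_diagonal_mul_swapMatrix]
    have h1 : (P : Matrix (Fin 3) (Fin 3) L) * (W * Matrix.diagonal ![a, b, a] * W) * ((P⁻¹ : GL (Fin 3) L) : Matrix (Fin 3) (Fin 3) L) =
        (((P * Wu : GL (Fin 3) L) : (Matrix (Fin 3) (Fin 3) L)ˣ).val) * Matrix.diagonal ![a, b, a] * (((P * Wu : GL (Fin 3) L) : (Matrix (Fin 3) (Fin 3) L)ˣ).val)⁻¹ := by
      rw [← Matrix.coe_units_inv, _root_.mul_inv_rev, Units.val_mul, Units.val_mul]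
      change _ = (P : Matrix (Fin 3) (Fin 3) L) * W * Matrix.diagonal ![a, b, a] * (W * ((P⁻¹ : GL (Fin 3) L) : Matrix (Fin 3) (Fin 3) L))
      simp only [Matrix.mul_assoc]
    rw [h1, Matrix.charpoly_units_conj, charpoly_diagonal_aba]

/-- **The (κ-MASS) pin**: if moreover `charpoly γ₀ = (X − e₁)²(X − e₂)`, the plane eigenvalue is `e₁`: `γ₀ = Q · diag(e₁, e₂, e₁) · Q⁻¹` with `c(e₁)e₁ = c(e₂)e₂ = 1`.
[cite: Rogawski1990, §3.8 Prop. 3.8.1 p. 27; §14.5 p. 239] -/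
theorem exists_eq_conj_diagonal_of_charpoly (hherm : (H'.map (cmConjRingHom L))ᵀ = H') (hanis : ∀ x : Fin 3 → L, hermForm (cmConjRingHom L) H' x x = 0 → x = 0)
    (γ₀ : unitaryGroup (cmConjRingHom L) H') {e₁ e₂ : L} (he : e₁ ≠ e₂)
    (hsplit : (((γ₀ : GL (Fin 3) L) : Matrix (Fin 3) (Fin 3) L) - e₁ • (1 : Matrix (Fin 3) (Fin 3) L)) * (((γ₀ : GL (Fin 3) L) : Matrix (Fin 3) (Fin 3) L) - e₂ • (1 : Matrix (Fin 3) (Fin 3) L)) = 0)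
    (hnc : ¬ ∃ ζ : L, ((γ₀ : GL (Fin 3) L) : Matrix (Fin 3) (Fin 3) L) = ζ • (1 : Matrix (Fin 3) (Fin 3) L))
    (hχ : ((γ₀ : GL (Fin 3) L) : Matrix (Fin 3) (Fin 3) L).charpoly = (X - C e₁) ^ 2 * (X - C e₂)) :
    ∃ Q : GL (Fin 3) L, cmConjRingHom L e₁ * e₁ = 1 ∧ cmConjRingHom L e₂ * e₂ = 1 ∧
      ((γ₀ : GL (Fin 3) L) : Matrix (Fin 3) (Fin 3) L) = (Q : Matrix (Fin 3) (Fin 3) L) * Matrix.diagonal ![e₁, e₂, e₁] * ((Q⁻¹ : GL (Fin 3) L) : Matrix (Fin 3) (Fin 3) L) := by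
  have hne₁ : ((γ₀ : GL (Fin 3) L) : Matrix (Fin 3) (Fin 3) L) ≠ e₁ • (1 : Matrix (Fin 3) (Fin 3) L) := fun h => hnc ⟨e₁, h⟩
  have hne₂ : ((γ₀ : GL (Fin 3) L) : Matrix (Fin 3) (Fin 3) L) ≠ e₂ • (1 : Matrix (Fin 3) (Fin 3) L) := fun h => hnc ⟨e₂, h⟩
  obtain ⟨a, b, Q, hab, ha, hb, hγ, hχ'⟩ := exists_eq_conj_diagonal_of_split L H' hherm hanis γ₀ he hsplit hne₁ hne₂
  rcases hab with ⟨rfl, rfl⟩ | ⟨rfl, rfl⟩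
  · exact ⟨Q, ha, hb, hγ⟩
  · exact absurd (hχ'.symm.trans hχ) (sq_mul_ne_sq_mul_of_ne he)

end Frame

/-! ## §3 The archimedean reading: `diag(d) ⊗ 1 = t(z_d)` and `γ₀ ⊗ 1 ∼ t(z_d)` in `GL₃(L ⊗ ℝ)` -/

section Arch

variable (L : Type) [Field L] [NumberField L] [IsCMField L] (H' : Matrix (Fin 3) (Fin 3) L) (α' : Fin 3 → L)

/-- **`diag(d) ⊗ 1 = t(z)`** in `M₃(L ⊗ ℝ)` whenever `z_{w,i} = σ_w(d_i)` (as complex numbers) — for ANY carrier weights `α′` (the matrix of the torus point does not see them;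
★ `coe_archDiagTorus_eq_diagonal`, no real places ★ `mixedSpace_ext`). [cite: BorelJacquet1979, §4.1] [cite: Rogawski1990, §8.2 p. 117] -/
theorem map_mixedEmbedding_diagonal_eq_coe_archDiagTorus (d : Fin 3 → L) (z : {w : InfinitePlace L // IsComplex w} → Fin 3 → Circle)
    (hz : ∀ (w : {w : InfinitePlace L // IsComplex w}) (i : Fin 3), ((z w i : Circle) : ℂ) = w.1.embedding (d i)) :
    (Matrix.diagonal d).map (mixedEmbedding L) =
      (((archDiagTorus L 3 α' z : arch (↥(maximalRealSubfield L)) L (IsCMField.complexConj L) 3 (Matrix.diagonal α')) : GL (Fin 3) (mixedSpace L)) :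
        Matrix (Fin 3) (Fin 3) (mixedSpace L)) := by
  rw [coe_archDiagTorus_eq_diagonal, Matrix.diagonal_map (map_zero _)]
  congr 1
  funext i
  exact mixedSpace_ext (↥(maximalRealSubfield L)) L (IsCMField.complexConj L) (IsCMField.complexConj_ne_one L) (complexConj_smul_infinitePlace L)
    fun w => by simp [mixedEmbedding_apply_isComplex, hz]

/-- **`γ₀ ⊗ 1` IS `GL₃(L ⊗ ℝ)`-CONJUGATE TO `t(z)`** whenever `γ₀ = Q · diag(d) · Q⁻¹` over `L` and `z_{w,i} = σ_w(d_i)` (conjugator `(Q ⊗ 1)⁻¹`; ★ `cmRationalToArch` is entrywise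
`mixedEmbedding`). [cite: Rogawski1990, §3.1 p. 19; §14.2 p. 232] [cite: BorelJacquet1979, §4.1] -/
theorem isConj_coe_cmRationalToArch_coe_archDiagTorus (γ₀ : (cmDatum L 3 H').Rational) {d : Fin 3 → L} (Q : GL (Fin 3) L)
    (hγ : (((γ₀ : unitaryGroup (cmConjRingHom L) H').val : GL (Fin 3) L) : Matrix (Fin 3) (Fin 3) L) =
      (Q : Matrix (Fin 3) (Fin 3) L) * Matrix.diagonal d * ((Q⁻¹ : GL (Fin 3) L) : Matrix (Fin 3) (Fin 3) L))
    (z : {w : InfinitePlace L // IsComplex w} → Fin 3 → Circle) (hz : ∀ (w : {w : InfinitePlace L // IsComplex w}) (i : Fin 3), ((z w i : Circle) : ℂ) = w.1.embedding (d i)) :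
    IsConj ((cmRationalToArch L 3 H' γ₀ : arch (↥(maximalRealSubfield L)) L (IsCMField.complexConj L) 3 H') : GL (Fin 3) (mixedSpace L))
      ((archDiagTorus L 3 α' z : arch (↥(maximalRealSubfield L)) L (IsCMField.complexConj L) 3 (Matrix.diagonal α')) : GL (Fin 3) (mixedSpace L)) := by
  refine isConj_iff.2 ⟨(Matrix.GeneralLinearGroup.map (mixedEmbedding L) Q)⁻¹, ?_⟩
  apply Units.ext
  have hx : (((cmRationalToArch L 3 H' γ₀ : arch (↥(maximalRealSubfield L)) L (IsCMField.complexConj L) 3 H') : GL (Fin 3) (mixedSpace L)) :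
      Matrix (Fin 3) (Fin 3) (mixedSpace L)) = (((γ₀ : unitaryGroup (cmConjRingHom L) H').val : GL (Fin 3) L) : Matrix (Fin 3) (Fin 3) L).map (mixedEmbedding L) := rfl
  have hQ : ((Matrix.GeneralLinearGroup.map (mixedEmbedding L) Q : GL (Fin 3) (mixedSpace L)) : Matrix (Fin 3) (Fin 3) (mixedSpace L)) =
      (Q : Matrix (Fin 3) (Fin 3) L).map (mixedEmbedding L) := rfl
  have hQ' : (((Matrix.GeneralLinearGroup.map (mixedEmbedding L) Q)⁻¹ : GL (Fin 3) (mixedSpace L)) : Matrix (Fin 3) (Fin 3) (mixedSpace L)) =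
      ((Q⁻¹ : GL (Fin 3) L) : Matrix (Fin 3) (Fin 3) L).map (mixedEmbedding L) := by
    rw [← map_inv]; rfl
  have hQQ : ((Q⁻¹ : GL (Fin 3) L) : Matrix (Fin 3) (Fin 3) L).map (mixedEmbedding L) * (Q : Matrix (Fin 3) (Fin 3) L).map (mixedEmbedding L) = 1 := by
    rw [← Matrix.map_mul, ← Units.val_mul, inv_mul_cancel, Units.val_one, Matrix.map_one _ (map_zero _) (map_one _)]
  rw [inv_inv, Units.val_mul, Units.val_mul, hx, hQ, hQ', hγ, Matrix.map_mul, Matrix.map_mul,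
    ← map_mixedEmbedding_diagonal_eq_coe_archDiagTorus L α' d z hz]
  calc ((Q⁻¹ : GL (Fin 3) L) : Matrix (Fin 3) (Fin 3) L).map (mixedEmbedding L) *
        ((Q : Matrix (Fin 3) (Fin 3) L).map (mixedEmbedding L) * (Matrix.diagonal d).map (mixedEmbedding L) * ((Q⁻¹ : GL (Fin 3) L) : Matrix (Fin 3) (Fin 3) L).map (mixedEmbedding L)) *
        (Q : Matrix (Fin 3) (Fin 3) L).map (mixedEmbedding L)
      = (((Q⁻¹ : GL (Fin 3) L) : Matrix (Fin 3) (Fin 3) L).map (mixedEmbedding L) * (Q : Matrix (Fin 3) (Fin 3) L).map (mixedEmbedding L)) * (Matrix.diagonal d).map (mixedEmbedding L) *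
          (((Q⁻¹ : GL (Fin 3) L) : Matrix (Fin 3) (Fin 3) L).map (mixedEmbedding L) * (Q : Matrix (Fin 3) (Fin 3) L).map (mixedEmbedding L)) := by
        simp only [Matrix.mul_assoc]
    _ = (Matrix.diagonal d).map (mixedEmbedding L) := by rw [hQQ, Matrix.one_mul, Matrix.mul_one]

end Arch

/-! ## §4 The heads: the wall torus point of a split rational element, stably, after any congruence to a diagonal carrier -/

section Head

variable (L : Type) [Field L] [NumberField L] [IsCMField L] (H' : Matrix (Fin 3) (Fin 3) L) (α' : Fin 3 → L) (S : GL (Fin 3) (mixedSpace L))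
  (Ψ : arch (↥(maximalRealSubfield L)) L (IsCMField.complexConj L) 3 H' ≃ₜ* arch (↥(maximalRealSubfield L)) L (IsCMField.complexConj L) 3 (Matrix.diagonal α'))
  (hΨ : ∀ g : arch (↥(maximalRealSubfield L)) L (IsCMField.complexConj L) 3 H',
    ((Ψ g : arch (↥(maximalRealSubfield L)) L (IsCMField.complexConj L) 3 (Matrix.diagonal α')) : GL (Fin 3) (mixedSpace L)) = S * (g : GL (Fin 3) (mixedSpace L)) * S⁻¹)

include hΨ in
/-- Along a congruence `Ψ : g ↦ S g S⁻¹`, `GL₃(L ⊗ ℝ)`-conjugacy of `x` to `y` is stable conjugacy of `Ψ x` to `y` in `U(diag α′)(L ⊗ ℝ)`. [cite: Rogawski1990, §3.1 p. 19; §14.4 p. 237] -/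
theorem isStablyConj_archCongr_of_isConj_coe {x : arch (↥(maximalRealSubfield L)) L (IsCMField.complexConj L) 3 H'}
    {y : arch (↥(maximalRealSubfield L)) L (IsCMField.complexConj L) 3 (Matrix.diagonal α')}
    (h : IsConj (x : GL (Fin 3) (mixedSpace L)) (y : GL (Fin 3) (mixedSpace L))) :
    IsStablyConj (conjMixed (↥(maximalRealSubfield L)) L (IsCMField.complexConj L)) (archFormOf L 3 (Matrix.diagonal α')) (Ψ x) y := by
  have h1 : IsConj ((Ψ x : arch (↥(maximalRealSubfield L)) L (IsCMField.complexConj L) 3 (Matrix.diagonal α')) : GL (Fin 3) (mixedSpace L)) (x : GL (Fin 3) (mixedSpace L)) := by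
    rw [hΨ x]
    exact isConj_iff.2 ⟨S⁻¹, by rw [inv_inv, ← mul_assoc, ← mul_assoc, inv_mul_cancel, one_mul, mul_assoc, inv_mul_cancel, mul_one]⟩
  exact h1.trans h

include hΨ in
/-- **(m2), (κ-MASS) SHAPE — THE WALL TORUS POINT OF A SPLIT RATIONAL ELEMENT.**  `H′` hermitian anisotropic, `γ₀ ∈ U(H′)(L⁺)` with `(γ₀ − e₁)(γ₀ − e₂) = 0`, `e₁ ≠ e₂`, non-central and
`charpoly γ₀ = (X − e₁)²(X − e₂)`; then `c(e₁)e₁ = c(e₂)e₂ = 1` and, for every congruence `Ψ : U(H′)(L ⊗ ℝ) ≃ U(diag α′)(L ⊗ ℝ)`, `g ↦ S g S⁻¹`, `Ψ(γ₀ ⊗ 1)` is STABLY CONJUGATE in `U(diag α′)(L ⊗ ℝ)` to the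
torus point `t(z⁰)`, `z⁰_w = (σ_w e₁, σ_w e₂, σ_w e₁)` — a wall point `z⁰_w 0 = z⁰_w 2 ≠ z⁰_w 1` at every `w` (the `hwall` of ★ p841776). [cite: Rogawski1990, §3.8 Prop. 3.8.1 p. 27; §14.2 p. 232; §8.2 p. 117] -/
theorem exists_isStablyConj_cmRationalToArch_archDiagTorus_wall (hherm : (H'.map (cmConjRingHom L))ᵀ = H')
    (hanis : ∀ x : Fin 3 → L, hermForm (cmConjRingHom L) H' x x = 0 → x = 0) (γ₀ : (cmDatum L 3 H').Rational) {e₁ e₂ : L} (he : e₁ ≠ e₂)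
    (hsplit : ((((γ₀ : unitaryGroup (cmConjRingHom L) H').val : GL (Fin 3) L) : Matrix (Fin 3) (Fin 3) L) - e₁ • (1 : Matrix (Fin 3) (Fin 3) L)) *
      ((((γ₀ : unitaryGroup (cmConjRingHom L) H').val : GL (Fin 3) L) : Matrix (Fin 3) (Fin 3) L) - e₂ • (1 : Matrix (Fin 3) (Fin 3) L)) = 0)
    (hnc : ¬ ∃ ζ : L, (((γ₀ : unitaryGroup (cmConjRingHom L) H').val : GL (Fin 3) L) : Matrix (Fin 3) (Fin 3) L) = ζ • (1 : Matrix (Fin 3) (Fin 3) L))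
    (hχ : (((γ₀ : unitaryGroup (cmConjRingHom L) H').val : GL (Fin 3) L) : Matrix (Fin 3) (Fin 3) L).charpoly = (X - C e₁) ^ 2 * (X - C e₂)) :
    ∃ (h₁ : (IsCMField.complexConj L e₁ : L) * e₁ = 1) (h₂ : (IsCMField.complexConj L e₂ : L) * e₂ = 1),
      IsStablyConj (conjMixed (↥(maximalRealSubfield L)) L (IsCMField.complexConj L)) (archFormOf L 3 (Matrix.diagonal α')) (Ψ (cmRationalToArch L 3 H' γ₀))
        (archDiagTorus L 3 α' fun w =>
          ![(⟨w.1.embedding e₁, mem_sphere_zero_iff_norm.mpr (norm_embedding_eq_one_of_complexConj_mul_self L e₁ h₁ w)⟩ : Circle),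
            ⟨w.1.embedding e₂, mem_sphere_zero_iff_norm.mpr (norm_embedding_eq_one_of_complexConj_mul_self L e₂ h₂ w)⟩,
            ⟨w.1.embedding e₁, mem_sphere_zero_iff_norm.mpr (norm_embedding_eq_one_of_complexConj_mul_self L e₁ h₁ w)⟩]) := by
  obtain ⟨Q, h₁, h₂, hγ⟩ := exists_eq_conj_diagonal_of_charpoly L H' hherm hanis (γ₀ : unitaryGroup (cmConjRingHom L) H') he hsplit hnc hχ
  exact ⟨h₁, h₂, isStablyConj_archCongr_of_isConj_coe L H' α' S Ψ hΨ
    (isConj_coe_cmRationalToArch_coe_archDiagTorus L H' α' γ₀ Q hγ _ fun w i => by fin_cases i <;> rfl)⟩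

include hΨ in
/-- **(m2), (ST-∞) SHAPE (swap-free)**: with `(γ₀ − e₁)(γ₀ − e₂) = 0`, `e₁ ≠ e₂` and `γ₀ ≠ e₁·1, e₂·1` only, there is the ordering `{a, b} = {e₁, e₂}` (plane eigenvalue `a`) with `c(a)a = c(b)b = 1`
and `Ψ(γ₀ ⊗ 1)` stably conjugate to the wall torus point `t(z⁰)`, `z⁰_w = (σ_w a, σ_w b, σ_w a)`. [cite: Rogawski1990, §3.8 Prop. 3.8.1 p. 27; §14.2 p. 232; §8.2 p. 117] -/
theorem exists_isStablyConj_cmRationalToArch_archDiagTorus_wall_of_ne_smul_one (hherm : (H'.map (cmConjRingHom L))ᵀ = H')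
    (hanis : ∀ x : Fin 3 → L, hermForm (cmConjRingHom L) H' x x = 0 → x = 0) (γ₀ : (cmDatum L 3 H').Rational) {e₁ e₂ : L} (he : e₁ ≠ e₂)
    (hsplit : ((((γ₀ : unitaryGroup (cmConjRingHom L) H').val : GL (Fin 3) L) : Matrix (Fin 3) (Fin 3) L) - e₁ • (1 : Matrix (Fin 3) (Fin 3) L)) *
      ((((γ₀ : unitaryGroup (cmConjRingHom L) H').val : GL (Fin 3) L) : Matrix (Fin 3) (Fin 3) L) - e₂ • (1 : Matrix (Fin 3) (Fin 3) L)) = 0)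
    (hne₁ : (((γ₀ : unitaryGroup (cmConjRingHom L) H').val : GL (Fin 3) L) : Matrix (Fin 3) (Fin 3) L) ≠ e₁ • (1 : Matrix (Fin 3) (Fin 3) L))
    (hne₂ : (((γ₀ : unitaryGroup (cmConjRingHom L) H').val : GL (Fin 3) L) : Matrix (Fin 3) (Fin 3) L) ≠ e₂ • (1 : Matrix (Fin 3) (Fin 3) L)) :
    ∃ (a b : L) (ha : (IsCMField.complexConj L a : L) * a = 1) (hb : (IsCMField.complexConj L b : L) * b = 1), ((a = e₁ ∧ b = e₂) ∨ (a = e₂ ∧ b = e₁)) ∧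
      (((γ₀ : unitaryGroup (cmConjRingHom L) H').val : GL (Fin 3) L) : Matrix (Fin 3) (Fin 3) L).charpoly = (X - C a) ^ 2 * (X - C b) ∧
      IsStablyConj (conjMixed (↥(maximalRealSubfield L)) L (IsCMField.complexConj L)) (archFormOf L 3 (Matrix.diagonal α')) (Ψ (cmRationalToArch L 3 H' γ₀))
        (archDiagTorus L 3 α' fun w =>
          ![(⟨w.1.embedding a, mem_sphere_zero_iff_norm.mpr (norm_embedding_eq_one_of_complexConj_mul_self L a ha w)⟩ : Circle),
            ⟨w.1.embedding b, mem_sphere_zero_iff_norm.mpr (norm_embedding_eq_one_of_complexConj_mul_self L b hb w)⟩,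
            ⟨w.1.embedding a, mem_sphere_zero_iff_norm.mpr (norm_embedding_eq_one_of_complexConj_mul_self L a ha w)⟩]) := by
  obtain ⟨a, b, Q, hab, ha, hb, hγ, hχ⟩ := exists_eq_conj_diagonal_of_split L H' hherm hanis (γ₀ : unitaryGroup (cmConjRingHom L) H') he hsplit hne₁ hne₂
  exact ⟨a, b, ha, hb, hab, hχ, isStablyConj_archCongr_of_isConj_coe L H' α' S Ψ hΨ
    (isConj_coe_cmRationalToArch_coe_archDiagTorus L H' α' γ₀ Q hγ _ fun w i => by fin_cases i <;> rfl)⟩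

/-- **THE WALL SHAPE** of `z⁰_w = (σ_w e₁, σ_w e₂, σ_w e₁)`: `z⁰_w 0 = z⁰_w 2` and `z⁰_w 0 ≠ z⁰_w 1` (`σ_w` is injective) — ★ p841776's `hwall`. [cite: Rogawski1990, §8.2 p. 117] -/
theorem archDiagTorus_wall_coords {e₁ e₂ : L} (he : e₁ ≠ e₂) (h₁ : (IsCMField.complexConj L e₁ : L) * e₁ = 1) (h₂ : (IsCMField.complexConj L e₂ : L) * e₂ = 1)
    (w : {w : InfinitePlace L // IsComplex w}) :
    (![(⟨w.1.embedding e₁, mem_sphere_zero_iff_norm.mpr (norm_embedding_eq_one_of_complexConj_mul_self L e₁ h₁ w)⟩ : Circle),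
        ⟨w.1.embedding e₂, mem_sphere_zero_iff_norm.mpr (norm_embedding_eq_one_of_complexConj_mul_self L e₂ h₂ w)⟩,
        ⟨w.1.embedding e₁, mem_sphere_zero_iff_norm.mpr (norm_embedding_eq_one_of_complexConj_mul_self L e₁ h₁ w)⟩] 0 =
      ![(⟨w.1.embedding e₁, mem_sphere_zero_iff_norm.mpr (norm_embedding_eq_one_of_complexConj_mul_self L e₁ h₁ w)⟩ : Circle),
        ⟨w.1.embedding e₂, mem_sphere_zero_iff_norm.mpr (norm_embedding_eq_one_of_complexConj_mul_self L e₂ h₂ w)⟩,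
        ⟨w.1.embedding e₁, mem_sphere_zero_iff_norm.mpr (norm_embedding_eq_one_of_complexConj_mul_self L e₁ h₁ w)⟩] 2) ∧
    (![(⟨w.1.embedding e₁, mem_sphere_zero_iff_norm.mpr (norm_embedding_eq_one_of_complexConj_mul_self L e₁ h₁ w)⟩ : Circle),
        ⟨w.1.embedding e₂, mem_sphere_zero_iff_norm.mpr (norm_embedding_eq_one_of_complexConj_mul_self L e₂ h₂ w)⟩,
        ⟨w.1.embedding e₁, mem_sphere_zero_iff_norm.mpr (norm_embedding_eq_one_of_complexConj_mul_self L e₁ h₁ w)⟩] 0 ≠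
      ![(⟨w.1.embedding e₁, mem_sphere_zero_iff_norm.mpr (norm_embedding_eq_one_of_complexConj_mul_self L e₁ h₁ w)⟩ : Circle),
        ⟨w.1.embedding e₂, mem_sphere_zero_iff_norm.mpr (norm_embedding_eq_one_of_complexConj_mul_self L e₂ h₂ w)⟩,
        ⟨w.1.embedding e₁, mem_sphere_zero_iff_norm.mpr (norm_embedding_eq_one_of_complexConj_mul_self L e₁ h₁ w)⟩] 1) := by
  refine ⟨rfl, fun h => he ?_⟩
  have h' := congrArg (fun z : Circle => (z : ℂ)) h
  exact w.1.embedding.injective h'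

end Head

end Literature.NumberTheory.Rogawski1990

end
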